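import Mathlib
import Summits.Schanuel.Schanuel.Theorems.RigidCoreMinimalCounterexampleInAclSecondLevelSelection
import Summits.Schanuel.Schanuel.Theorems.RigidCoreMinimalCounterexampleInAclSelectionCoreTwoSided
import Summits.Schanuel.Schanuel.Theorems.RigidCoreMinimalCounterexampleInAclProdExpDegenerate
import Summits.Schanuel.Schanuel.Theorems.RigidCoreMinimalCounterexampleInAclMatesLocallyFiniteSnd

/-!
# Second-level selection with the MIXED gadget `e^{x₀x₁}` — crux stmt-Schanuel-0969 `RigidCore.MinimalCounterexampleInAcl`

Route `RigidCore`, crux (S*) `MinimalCounterexampleInAcl` (item stmt-Schanuel-0969), line `kernel-arithmetic-selection`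
(lead prover-line-stmt-Schanuel-0969-c6-0, skeleton gen 19), `--supports stmt-Schanuel-0969`; registered stubs
`stub_secondLevelSelectionProd` and `crux_iff_quadraticResidue_and_geThree`.

The gadget `Φ(y) = e^{y₀y₁}` degenerates super-polynomially along the mates of a rank-2 first failure with BOTH signs
(`Re(y₀y₁) = Re y₀ Re y₁ − Im y₀ Im y₁`, `|Re yᵢ| = O(log ‖y₀‖)`, `|Im y₀| ~ ‖y₀‖`, `|Im y₁| ≥ 1` on far mates:
`stub_prodExpDegenerate`, Theorems/…ProdExpDegenerate.lean p125575, with `stub_matesLocallyFiniteSnd` p125390), so the TWO-SIDED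
selection core (`selectionCoreTwoSided_of_head`, …SelectionCoreTwoSided.lean p125611) applies:

* `secondLevel_prod`, **`stub_secondLevelSelectionProd`: if `x` is a rank-2 first failure and `e^{x₀x₁}` is ALGEBRAIC over
  `ℚ(x, eˣ)` then `x ∈ acl(∅)²`**;
* **`crux_iff_quadraticResidue_and_geThree`: (S*) ⟺ [(S*)₂ for PURE first failures with `e^{x₀²}`, `e^{x₀x₁}`, `e^{x₁²}` ALL
  transcendental over `ℚ(x, eˣ)`] ∧ item stmt-14744** — the pure rank-2 residue of the crux after gen 19: a counterexample to (S*)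
  of rank 2 is pure, has infinitely many mates, and is transcendental at every quadratic exponential gadget.
-/

noncomputable section

set_option linter.dupNamespace false

open Complex Set FirstOrder

namespace Summit.Schanuel.Schanuel.Cruxes.MinimalCounterexampleInAcl.KernelArithmeticSelection

open Literature.NumberTheory.Transcendental (SchanuelRank)
open Literature.ModelTheory.ExponentialFields
open Summit.Schanuel.Schanuel.Theorems.AclSubsetLogFreeCore.Negative
open Summit.Schanuel.Schanuel.Theses.RigidCore (MinimalCounterexampleInAcl MinimalCounterexampleInAclGeThree)

/-- `y ↦ e^{y₀y₁}` is a `∅`-definable function on `ℂ_exp`. [folklore] -/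
theorem definableFun_cexp_prod :
    (∅ : Set ℂ).DefinableFun Language.expRing (fun y : Fin 2 → ℂ => cexp (y 0 * y 1)) :=
  definableFun_cexp (definableFun_mul' (definableFun_proj_params (A := (∅ : Set ℂ))
    (L := Language.expRing) (α := Fin 2) 0) (definableFun_proj_params 1))

/-- **SECOND-LEVEL SELECTION WITH THE MIXED GADGET: if `e^{x₀x₁}` is algebraic over `ℚ(x, eˣ)` then `x ∈ acl(∅)²`** (rank-2
first failure `x`; no purity, no finiteness of mates).  An algebraic coordinate is settled by the landed acl-criterion; otherwise
the normal form of the relation, the two-sided degeneration of `e^{y₀y₁}` along the mates, the growth of the coefficients, local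
finiteness of the mates in both coordinates, and the two-sided selection core. [cite: KirbyMacintyreOnshuus2012, §2] -/
theorem secondLevel_prod {x : Fin 2 → ℂ} (hx : x ∈ firstFailures 2)
    (halg : IsAlgebraic ↥(IntermediateField.adjoin ℚ (range x ∪ range (cexp ∘ x))) (cexp (x 0 * x 1))) :
    ∀ i, x i ∈ expAcl := by
  by_cases h0 : IsAlgebraic ℚ (x 0)
  · exact firstFailure_two_mem_expAcl_of_isAlgebraic_coord hx h0
  by_cases h1 : IsAlgebraic ℚ (x 1)
  · exact firstFailure_two_mem_expAcl_of_isAlgebraic_coord hx h1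
  have hx0 : Transcendental ℚ (x 0) := h0
  have hx1 : Transcendental ℚ (x 1) := h1
  obtain ⟨d, c, hc0, hrel⟩ := stub_relationNormalForm x (cexp (x 0 * x 1)) (Complex.exp_ne_zero _) halg
  exact selectionCoreTwoSided_of_head hx definableFun_cexp_prod
    (stub_prodExpDegenerate x hx hx0 hx1 (stub_matesLocallyFiniteSnd x hx hx1))
    (stub_mateCoeffGrowth x hx.2.1 hx0) (stub_matesLocallyFinite x hx hx0) c hc0 hrel

/-- **Registered stub `stub_secondLevelSelectionProd` (PROVED).**  For a rank-2 first failure `x`: if `e^{x₀x₁}` is algebraic over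
`ℚ(x, eˣ)` then every coordinate of `x` lies in a finite `∅`-definable subset of `ℂ_exp`. [cite: KirbyMacintyreOnshuus2012, §2] -/
theorem stub_secondLevelSelectionProd : ∀ (x : Fin 2 → ℂ), x ∈ Summit.Schanuel.Schanuel.Cruxes.MinimalCounterexampleInAcl.KernelArithmeticSelection.firstFailures 2 → IsAlgebraic ↥(IntermediateField.adjoin ℚ (Set.range x ∪ Set.range (Complex.exp ∘ x))) (Complex.exp (x 0 * x 1)) → ∀ i, x i ∈ Summit.Schanuel.Schanuel.Theorems.AclSubsetLogFreeCore.Negative.expAcl :=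
  fun _ hx halg => secondLevel_prod hx halg

/-- **The second-level-generic residue ⟺ its quadratic-generic part**: mates with `e^{x₀x₁}` algebraic are settled as well.
[cite: KirbyMacintyreOnshuus2012, §2] -/
theorem secondLevelResidue_iff_quadraticResidue :
    (∀ x : Fin 2 → ℂ, x ∈ firstFailures 2 →
        (∀ M : Fin 2 → ℤ, M ≠ 0 → Transcendental ℚ (cexp (∑ i, (M i : ℂ) * x i))) →
        Transcendental ↥(IntermediateField.adjoin ℚ (range x ∪ range (cexp ∘ x))) (cexp (x 0 ^ 2)) →
        Transcendental ↥(IntermediateField.adjoin ℚ (range x ∪ range (cexp ∘ x))) (cexp (x 1 ^ 2)) →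
        ∀ i, x i ∈ expAcl) ↔
      ∀ x : Fin 2 → ℂ, x ∈ firstFailures 2 →
        (∀ M : Fin 2 → ℤ, M ≠ 0 → Transcendental ℚ (cexp (∑ i, (M i : ℂ) * x i))) →
        Transcendental ↥(IntermediateField.adjoin ℚ (range x ∪ range (cexp ∘ x))) (cexp (x 0 ^ 2)) →
        Transcendental ↥(IntermediateField.adjoin ℚ (range x ∪ range (cexp ∘ x))) (cexp (x 0 * x 1)) →
        Transcendental ↥(IntermediateField.adjoin ℚ (range x ∪ range (cexp ∘ x))) (cexp (x 1 ^ 2)) →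
        ∀ i, x i ∈ expAcl := by
  refine ⟨fun h x hx hpure h0 _ h1 i => h x hx hpure h0 h1 i, fun h x hx hpure h0 h1 i => ?_⟩
  by_cases h01 : IsAlgebraic ↥(IntermediateField.adjoin ℚ (range x ∪ range (cexp ∘ x))) (cexp (x 0 * x 1))
  · exact secondLevel_prod hx h01 i
  · exact h x hx hpure h0 h01 h1 i

/-- **Registered stub `crux_iff_quadraticResidue_and_geThree` (PROVED): THE QUADRATIC SPLIT** — (S*) holds iff (i) every PURE
rank-2 first failure that is QUADRATICALLY GENERIC (`e^{x₀²}`, `e^{x₀x₁}`, `e^{x₁²}` all transcendental over `ℚ(x, eˣ)`) has both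
coordinates in `acl^{ℂ_exp}(∅)`, and (ii) item stmt-Schanuel-14744 (`MinimalCounterexampleInAclGeThree`, ranks `≥ 3`) holds.
[cite: Kirby2010, Prop. 7.2] -/
theorem crux_iff_quadraticResidue_and_geThree : Summit.Schanuel.Schanuel.Theses.RigidCore.MinimalCounterexampleInAcl ↔ ((∀ x : Fin 2 → ℂ, x ∈ Summit.Schanuel.Schanuel.Cruxes.MinimalCounterexampleInAcl.KernelArithmeticSelection.firstFailures 2 → (∀ M : Fin 2 → ℤ, M ≠ 0 → Transcendental ℚ (Complex.exp (∑ i, (M i : ℂ) * x i))) → Transcendental ↥(IntermediateField.adjoin ℚ (Set.range x ∪ Set.range (Complex.exp ∘ x))) (Complex.exp (x 0 ^ 2)) → Transcendental ↥(IntermediateField.adjoin ℚ (Set.range x ∪ Set.range (Complex.exp ∘ x))) (Complex.exp (x 0 * x 1)) → Transcendental ↥(IntermediateField.adjoin ℚ (Set.range x ∪ Set.range (Complex.exp ∘ x))) (Complex.exp (x 1 ^ 2)) → ∀ i, x i ∈ Summit.Schanuel.Schanuel.Theorems.AclSubsetLogFreeCore.Negative.expAcl) ∧ Summit.Schanuel.Schanuel.Theses.RigidCore.MinimalCounterexampleInAclGeThree)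 := by
  rw [crux_iff_secondLevelResidue_and_geThree, secondLevelResidue_iff_quadraticResidue]

/-- **(S*) from the quadratic-generic pure residue and item stmt-14744.** [cite: Kirby2010, Prop. 7.2] -/
theorem crux_of_quadraticResidue_of_geThree
    (hR : ∀ x : Fin 2 → ℂ, x ∈ firstFailures 2 →
        (∀ M : Fin 2 → ℤ, M ≠ 0 → Transcendental ℚ (cexp (∑ i, (M i : ℂ) * x i))) →
        Transcendental ↥(IntermediateField.adjoin ℚ (range x ∪ range (cexp ∘ x))) (cexp (x 0 ^ 2)) →
        Transcendental ↥(IntermediateField.adjoin ℚ (range x ∪ range (cexp ∘ x))) (cexp (x 0 * x 1)) →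
        Transcendental ↥(IntermediateField.adjoin ℚ (range x ∪ range (cexp ∘ x))) (cexp (x 1 ^ 2)) →
        ∀ i, x i ∈ expAcl)
    (h₃ : MinimalCounterexampleInAclGeThree) : MinimalCounterexampleInAcl :=
  crux_iff_quadraticResidue_and_geThree.2 ⟨hR, h₃⟩

end Summit.Schanuel.Schanuel.Cruxes.MinimalCounterexampleInAcl.KernelArithmeticSelection

end
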